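import Summits.AnomalousDissipation.AnomalousDissipation.Theses.TaylorCertificates

/-!
# crux-plan sketch — line `laminar-ray-invisible-beat` for crux `TaylorCertificates.TaylorCertificatePair`
(item stmt-AnomalousDissipation-13037; planner-cruxplan-…-laminar-ray-invisibl-0, 2026-08-15)

The idea (crux workfile `Cruxes/TaylorCertificatePair/Ideas/laminar-beat.md`) is a NEGATIVE line: it proves
`¬ TaylorCertificatePair` (CEILING half killed by a laminar shear ray + a Taylor-invisible beat). This file
records, over the route's declarations and with `lean check` rc 0:

* `CeilingKill`      — the ∀-form theorem of the negative line (for every force: small-ν violation of the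
                       certificate pair by an explicit state; `f = 0` is covered by FLOOR at rest inside the
                       same shape), i.e. what stubs L1 (laminar-ray identity) + L2 (invisible beat) + the §2
                       bookkeeping of the card deliver;
* `not_TaylorCertificatePair_of_ceilingKill : CeilingKill → ¬ TaylorCertificatePair` — PROVED (pure logic):
                       the audit reads it as `refutes` the crux decl, i.e. this line can only ever be a negative
                       edge, never a `…_of : stubs → TaylorCertificatePair` skeleton (the crux-plan gate
                       `#h21_check_skeleton` wants the conclusion head to be the crux decl BY NAME);
* `TaylorFloor`      — the positive residue of the line (card §4/§5, triage r1-1/2/3 `sharpen`): the FLOOR half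
                       of the crux in the same Taylor class, verbatim the crux with `Φ₂, θ₂` and the CEILING
                       conjunct deleted — a candidate repaired item for the tenure planner, NOT filed here;
* `taylorFloor_of_taylorCertificatePair : TaylorCertificatePair → TaylorFloor` — PROVED (projection), so the
                       residue is implied by the crux and is untouched by the refutation (which kills CEILING only).
-/

namespace Summit.AnomalousDissipation.AnomalousDissipation.Cruxes.TaylorCertificatePair.LaminarRayInvisibleBeat

open MeasureTheory
open Literature.Analysis.FunctionSpaces Literature.Analysis.FluidPDE

/-- What the negative line proves (card §2, quantifier order respected: `ν₁ = ν₁(f,E,C,Θ)` is fixed BEFORE the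
certificate `(N, Φ₁, Φ₂, θ₁, θ₂)` is chosen, the violating state `u` AFTER). For `f ≠ 0` the witness violates the
CEILING conjunct (laminar ray `u₁ = R₁v`, `(v,f)=0`, `R₁² = 8‖f‖²/ν²`, plus the invisible beat `w`); for `f = 0`
the witness `u = 0` violates the FLOOR conjunct (`ε₀ ≤ 0`). -/
def CeilingKill : Prop :=
  ∀ f : UnitAddTorus (Fin 3) → EuclideanSpace ℝ (Fin 3), Torus.IsSmooth f → Torus.IsDivFree f → Torus.HasZeroMean f →
  ∀ (ε₀ E C Θ : ℝ), 0 < ε₀ → ∃ ν₁ : ℝ, 0 < ν₁ ∧ ∀ ν : ℝ, 0 < ν → ν < ν₁ →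
  ∀ (N : ℕ) (Φ₁ Φ₂ : Torus.CylindricalTest (Fin 3)) (θ₁ θ₂ : ℝ), (N : ℝ) ≤ C * ν ^ (-(1 / 2 : ℝ)) →
  (∀ i, Torus.fourierTruncate N (Φ₁.g i) = Φ₁.g i) → (∀ i, Torus.fourierTruncate N (Φ₂.g i) = Φ₂.g i) →
  -Θ ≤ θ₁ → θ₁ ≤ 0 → -Θ ≤ θ₂ → θ₂ ≤ 0 →
  ∃ u : Torus.energySpace (Fin 3),
    let uf : UnitAddTorus (Fin 3) → EuclideanSpace ℝ (Fin 3) := ((u : Lp (EuclideanSpace ℝ (Fin 3)) 2 (volume : Measure (UnitAddTorus (Fin 3)))) : UnitAddTorus (Fin 3) → EuclideanSpace ℝ (Fin 3))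
    let D : ℝ := ν * (Torus.eGradNormSq uf).toReal
    let P : ℝ := Torus.pairing (u : Lp (EuclideanSpace ℝ (Fin 3)) 2 (volume : Measure (UnitAddTorus (Fin 3)))) f - D
    Torus.eGradNormSq uf ≠ ⊤ ∧ ‖u‖ ^ 2 ≤ 16 * (∫ x, ‖f x‖ ^ 2) / ν ^ 2 ∧
    ¬ (ε₀ ≤ D + Torus.nsGeneratorPairing ν f u (Φ₁.grad u) + 2 * θ₁ * P ∧
       ‖u‖ ^ 2 - E ≤ Torus.nsGeneratorPairing ν f u (Φ₂.grad u) + 2 * θ₂ * P)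

/-- Pure-logic glue: the ∀-form kill refutes the crux BY NAME. (Audit: `refutes.conditional` on
`TaylorCertificates.TaylorCertificatePair` — a negative edge, not a skeleton.) -/
theorem not_TaylorCertificatePair_of_ceilingKill (hK : CeilingKill) :
    ¬ Summit.AnomalousDissipation.AnomalousDissipation.Theses.TaylorCertificates.TaylorCertificatePair := by
  rintro ⟨f, hfs, hfd, hfm, ε₀, E, C, Θ, ν₀, hε₀, hν₀, hcert⟩
  obtain ⟨ν₁, hν₁, hkill⟩ := hK f hfs hfd hfm ε₀ E C Θ hε₀
  -- a viscosity below both thresholds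
  set ν : ℝ := min ν₀ ν₁ / 2 with hνdef
  have hmin : 0 < min ν₀ ν₁ := lt_min hν₀ hν₁
  have hνpos : 0 < ν := by rw [hνdef]; linarith
  have hν0 : ν < ν₀ := by
    rw [hνdef]; have := min_le_left ν₀ ν₁; linarith
  have hν1 : ν < ν₁ := by
    rw [hνdef]; have := min_le_right ν₀ ν₁; linarith
  obtain ⟨N, Φ₁, Φ₂, θ₁, θ₂, hN, hg₁, hg₂, hθ₁l, hθ₁u, hθ₂l, hθ₂u, hall⟩ := hcert ν hνpos hν0
  obtain ⟨u, hfin, hball, hviol⟩ := hkill ν hνpos hν1 N Φ₁ Φ₂ θ₁ θ₂ hN hg₁ hg₂ hθ₁l hθ₁u hθ₂l hθ₂u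
  exact hviol (hall u hfin hball)

/-- The positive residue of the line (card §4/§5; triage r1-1/2/3): the FLOOR half of the crux in the Taylor
class — verbatim `TaylorCertificatePair` with the ceiling functional `Φ₂`, its weight `θ₂`, the budget `E` and the
CEILING conjunct deleted. Candidate repaired item for the tenure planner (the CEILING needs another species:
resolution `N ≳ c(f)/ν`, the ensemble statement, or a non-pointwise device — card §3/§5). NOT filed by this seat. -/
def TaylorFloor : Prop :=
  ∃ f : UnitAddTorus (Fin 3) → EuclideanSpace ℝ (Fin 3), Torus.IsSmooth f ∧ Torus.IsDivFree f ∧ Torus.HasZeroMean f ∧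
  ∃ (ε₀ C Θ ν₀ : ℝ), 0 < ε₀ ∧ 0 < ν₀ ∧ ∀ ν : ℝ, 0 < ν → ν < ν₀ →
  ∃ (N : ℕ) (Φ₁ : Torus.CylindricalTest (Fin 3)) (θ₁ : ℝ), (N : ℝ) ≤ C * ν ^ (-(1 / 2 : ℝ)) ∧
  (∀ i, Torus.fourierTruncate N (Φ₁.g i) = Φ₁.g i) ∧ -Θ ≤ θ₁ ∧ θ₁ ≤ 0 ∧
  ∀ u : Torus.energySpace (Fin 3),
    let uf : UnitAddTorus (Fin 3) → EuclideanSpace ℝ (Fin 3) := ((u : Lp (EuclideanSpace ℝ (Fin 3)) 2 (volume : Measure (UnitAddTorus (Fin 3)))) : UnitAddTorus (Fin 3) → EuclideanSpace ℝ (Fin 3))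
    let D : ℝ := ν * (Torus.eGradNormSq uf).toReal
    let P : ℝ := Torus.pairing (u : Lp (EuclideanSpace ℝ (Fin 3)) 2 (volume : Measure (UnitAddTorus (Fin 3)))) f - D
    Torus.eGradNormSq uf ≠ ⊤ → ‖u‖ ^ 2 ≤ 16 * (∫ x, ‖f x‖ ^ 2) / ν ^ 2 →
    ε₀ ≤ D + Torus.nsGeneratorPairing ν f u (Φ₁.grad u) + 2 * θ₁ * P

/-- The residue is implied by the crux (projection onto the FLOOR conjunct), hence consistent with everything the
refutation shows (which kills the CEILING conjunct only). -/
theorem taylorFloor_of_taylorCertificatePair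
    (h : Summit.AnomalousDissipation.AnomalousDissipation.Theses.TaylorCertificates.TaylorCertificatePair) :
    TaylorFloor := by
  obtain ⟨f, hfs, hfd, hfm, ε₀, E, C, Θ, ν₀, hε₀, hν₀, hcert⟩ := h
  refine ⟨f, hfs, hfd, hfm, ε₀, C, Θ, ν₀, hε₀, hν₀, fun ν hν hν' => ?_⟩
  obtain ⟨N, Φ₁, Φ₂, θ₁, θ₂, hN, hg₁, hg₂, hθ₁l, hθ₁u, hθ₂l, hθ₂u, hall⟩ := hcert ν hν hν'
  exact ⟨N, Φ₁, θ₁, hN, hg₁, hθ₁l, hθ₁u, fun u hfin hball => (hall u hfin hball).1⟩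

end Summit.AnomalousDissipation.AnomalousDissipation.Cruxes.TaylorCertificatePair.LaminarRayInvisibleBeat
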